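import Summits.AtomisticToContinuum.BoseEinsteinCondensation.Theorems.BECCutLineWeakDisorderGroundStateRigidityStubLocalTube
import HarnessLib

/-!
# Crux `GroundStateRigidity` (stmt-AtomisticToContinuum-9072), line `Sketch`:
# the registered stub `stub_localTubeCore`

Supports (does not close) stmt-AtomisticToContinuum-9072; stub `stub_localTubeCore` of line
Sketch. **A tube lower bound for `(e^{-H(w)} 1_A)(Y')` with GIVEN clearance, uniform in the start
`Y'` near `Y` and in the hard-core potential `w`.** Along the straight segment `[Y, X⋆]` all pairs
stay `≥ b + 2m`; hence every configuration within coordinate distance `η` of the segment, with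
`4η ≤ m`, has all pairs `≥ b + m` (`√3 ≤ 2`), so the tube never samples `w` below `b + m`, where
only the bound `w ≤ C` is used. Uniformity in the start: the `ε`-neighbourhood of `[Y', X⋆]` lies
in the `(ε + δ₀)`-neighbourhood of `[Y, X⋆]`, and the rational tube event of half-width `ε / 2`
for the drift `X⋆ - Y` is contained in the tube event of half-width `ε` for the drift `X⋆ - Y'`
whenever `|Y' - Y|_∞ ≤ δ₀ ≤ ε / 2`, which bounds the tube probability from below independently of
`Y'`. The rest is the assembly of the template `stub_localTube` (semigroup law, free killed
functional of a translated small box, positivity improving and strong Feller at `v = 0`,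
`LocalTube.fkReal_ge_of_localTube`). Chung–Zhao (1995), Thm 2.4, localised to a tube.
-/

noncomputable section

open MeasureTheory Filter Set Metric
open scoped ENNReal NNReal Topology

namespace Summit.AtomisticToContinuum.BoseEinsteinCondensation.Theorems.GroundStateRigidity

open Literature.MathematicalPhysics.QuantumManyBody.BoseGas
open Literature.Probability.Process

namespace LocalTubeCore

variable {N : ℕ}

/-! ### Given clearance: pairs stay `≥ b + m` near the segment -/

/-- **Pairs near a segment of clearance `b + 2m`.** If all pair differences along the segment
`θ ↦ (1 - θ) Y + θ X⋆`, `θ ∈ [0, 1]`, have norm `≥ b + 2m`, then every configuration within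
coordinate distance `η` of a point of the segment, `4η ≤ m`, has all pair distances `≥ b + m`
(`dist ≤ √3 η ≤ 2η` per particle, triangle inequality). [folklore] -/
theorem pair_ge_of_clearance {Y Xs : Config N} {b m : ℝ}
    (hseg : ∀ θ : ℝ, θ ∈ Set.Icc (0 : ℝ) 1 → ∀ i j : Fin N, i ≠ j →
      b + 2 * m ≤ ‖(1 - θ) • (Y i - Y j) + θ • (Xs i - Xs j)‖)
    {η : ℝ} (hη0 : 0 ≤ η) (hη : 4 * η ≤ m) {θ : ℝ} (hθ : θ ∈ Set.Icc (0 : ℝ) 1) {W : Config N}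
    (hW : ∀ i k, |W i k - ((1 - θ) * Y i k + θ * Xs i k)| ≤ η) :
    ∀ i j : Fin N, i ≠ j → b + m ≤ dist (W i) (W j) := by
  have h32 : Real.sqrt 3 ≤ 2 := (Real.sqrt_le_left (by norm_num)).2 (by norm_num)
  intro i j hij
  set P : Config N := fun i => (1 - θ) • Y i + θ • Xs i with hP
  have hPik : ∀ i' k', P i' k' = (1 - θ) * Y i' k' + θ * Xs i' k' := by
    intro i' k'
    simp [hP]
  have hWP : dist W P ≤ Real.sqrt 3 * η :=
    dist_le_of_abs_coord_le hη0 fun i' k' => by rw [hPik]; exact hW i' k'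
  have hPij : b + 2 * m ≤ dist (P i) (P j) := by
    rw [dist_eq_norm]
    have hdiff : P i - P j = (1 - θ) • (Y i - Y j) + θ • (Xs i - Xs j) := by
      simp only [hP, smul_sub]
      abel
    rw [hdiff]
    exact hseg θ hθ i j hij
  linarith [dist_le_pi_dist W P i, dist_le_pi_dist W P j, dist_triangle4 (P i) (W i) (W j) (P j),
    dist_comm (P i) (W i), mul_le_mul_of_nonneg_right h32 hη0]

/-- **Shifting the start of a segment.** A configuration within coordinate distance `ε` of the
point of parameter `θ ∈ [0, 1]` on `[Y', X⋆]` is within `ε + δ₀` of the point of the same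
parameter on `[Y, X⋆]` when `|Y' - Y|_∞ ≤ δ₀` (the two points differ by `(1 - θ)(Y' - Y)`).
[folklore] -/
theorem abs_sub_segment_le_add {Y Y' Xs W : Config N} {θ ε δ₀ : ℝ}
    (hθ : θ ∈ Set.Icc (0 : ℝ) 1) (hY' : ∀ i k, |Y' i k - Y i k| ≤ δ₀)
    (hW : ∀ i k, |W i k - ((1 - θ) * Y' i k + θ * Xs i k)| ≤ ε) (i : Fin N) (k : Fin 3) :
    |W i k - ((1 - θ) * Y i k + θ * Xs i k)| ≤ ε + δ₀ := by
  have h3 : |(1 - θ) * (Y' i k - Y i k)| ≤ δ₀ := by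
    rw [abs_mul, abs_of_nonneg (sub_nonneg.2 hθ.2)]
    calc (1 - θ) * |Y' i k - Y i k| ≤ 1 * |Y' i k - Y i k| :=
          mul_le_mul_of_nonneg_right (sub_le_self _ hθ.1) (abs_nonneg _)
      _ ≤ δ₀ := by rw [one_mul]; exact hY' i k
  calc |W i k - ((1 - θ) * Y i k + θ * Xs i k)|
      = |(W i k - ((1 - θ) * Y' i k + θ * Xs i k)) + (1 - θ) * (Y' i k - Y i k)| := by
        congr 1; ring
    _ ≤ |W i k - ((1 - θ) * Y' i k + θ * Xs i k)| + |(1 - θ) * (Y' i k - Y i k)| :=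
        abs_add_le _ _
    _ ≤ ε + δ₀ := add_le_add (hW i k) h3

/-! ### Uniformity of the tube event in the start point -/

/-- **Tube events for nearby drifts are nested.** The rational tube event of half-width
`(ε/2)/√2` around the line of drift `(X⋆ - Y)/√2` is contained in the tube event of half-width
`ε/√2` around the line of drift `(X⋆ - Y')/√2` whenever `|Y' - Y|_∞ ≤ δ₀ ≤ ε / 2`: at time
`q ≤ t` the two centres differ by `(q/t) |Y' - Y| / √2 ≤ δ₀ / √2` coordinatewise. [folklore] -/
theorem ratTube_subset_of_near {Y Y' Xs : Config N} {t : ℝ≥0} {ε δ₀ : ℝ} (hδ₀ : δ₀ ≤ ε / 2)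
    (hY' : ∀ i k, |Y' i k - Y i k| ≤ δ₀) :
    {ω : PathSpace N | ∀ (i : Fin N) (k : Fin 3) (q : ℚ), (q : ℝ) ∈ Set.Icc (0 : ℝ) t →
      |brownian (q : ℝ).toNNReal (ω i k) - ((q : ℝ) / t) * ((Xs i k - Y i k) / Real.sqrt 2)| ≤
        ε / 2 / Real.sqrt 2} ⊆
    {ω : PathSpace N | ∀ (i : Fin N) (k : Fin 3) (q : ℚ), (q : ℝ) ∈ Set.Icc (0 : ℝ) t →
      |brownian (q : ℝ).toNNReal (ω i k) - ((q : ℝ) / t) * ((Xs i k - Y' i k) / Real.sqrt 2)| ≤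
        ε / Real.sqrt 2} := by
  intro ω hω i k q hq
  have h2 : (0 : ℝ) < Real.sqrt 2 := Real.sqrt_pos.2 (by norm_num)
  have h := hω i k q hq
  have hqt : 0 ≤ (q : ℝ) / t ∧ (q : ℝ) / t ≤ 1 := by
    rcases eq_or_ne t 0 with ht | ht
    · simp [ht]
    · have ht0 : (0 : ℝ) < t := by exact_mod_cast pos_iff_ne_zero.2 ht
      exact ⟨div_nonneg hq.1 t.coe_nonneg, (div_le_one ht0).2 hq.2⟩
  have hdiff : |((q : ℝ) / t) * ((Xs i k - Y i k) / Real.sqrt 2) -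
      ((q : ℝ) / t) * ((Xs i k - Y' i k) / Real.sqrt 2)| ≤ δ₀ / Real.sqrt 2 := by
    rw [← mul_sub, ← sub_div, abs_mul, abs_of_nonneg hqt.1, abs_div, abs_of_pos h2,
      show Xs i k - Y i k - (Xs i k - Y' i k) = Y' i k - Y i k by ring]
    calc (q : ℝ) / t * (|Y' i k - Y i k| / Real.sqrt 2)
        ≤ 1 * (|Y' i k - Y i k| / Real.sqrt 2) :=
          mul_le_mul_of_nonneg_right hqt.2 (by positivity)
      _ ≤ δ₀ / Real.sqrt 2 := by
          rw [one_mul]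
          exact div_le_div_of_nonneg_right (hY' i k) h2.le
  calc |brownian (q : ℝ).toNNReal (ω i k) - ((q : ℝ) / t) * ((Xs i k - Y' i k) / Real.sqrt 2)|
      = |(brownian (q : ℝ).toNNReal (ω i k) - ((q : ℝ) / t) * ((Xs i k - Y i k) / Real.sqrt 2)) +
          (((q : ℝ) / t) * ((Xs i k - Y i k) / Real.sqrt 2) -
            ((q : ℝ) / t) * ((Xs i k - Y' i k) / Real.sqrt 2))| := by
        congr 1; ring
    _ ≤ ε / 2 / Real.sqrt 2 + δ₀ / Real.sqrt 2 := (abs_add_le _ _).trans (add_le_add h hdiff)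
    _ ≤ ε / Real.sqrt 2 := by
        rw [← add_div]
        exact div_le_div_of_nonneg_right (by linarith) h2.le

end LocalTubeCore

open LocalTube LocalTubeCore in
/-- **Stub `stub_localTubeCore` — a tube lower bound for `e^{-H(w)} 1_A` with given clearance,
uniform in the start and in the hard core.** Let `Y, X⋆` lie in the open box with all pairs
`≥ b + 2m` along the segment `[Y, X⋆]`, and let the measurable set `A` charge every coordinate box
around `X⋆`. Then for every bound `C` there are `c > 0` and `δ₀ > 0` with `(e^{-H(w)} 1_A)(Y') ≥ c`
for EVERY start `Y'` with `|Y' - Y|_∞ ≤ δ₀` and EVERY measurable `w` with `w ≤ C` on `[b + m, ∞)`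
(whatever `w` does below `b + m`, e.g. a hard core `w = ⊤` on `[0, b]`): semigroup law
`e^{-H} = e^{-H/2} e^{-H/2}` (`fkReal_add_time`); `h = e^{-H(w)/2} 1_A ≥ a > 0` near `X⋆` uniformly
in `w` (`exp_mul_fkReal_shift_le`, `fkReal_pos_of_nonneg` and `continuousAt_fkReal` at `v = 0`);
the tube bound along `[Y', X⋆]` with the interaction bounded ON THE TUBE only
(`fkReal_ge_of_localTube`, `pair_ge_of_clearance`, `abs_sub_segment_le_add`), and the tube
probability bounded below uniformly in `Y'` (`ratTube_subset_of_near`, `measure_ratTube_pos`).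
Chung–Zhao (1995), Thm 2.4, localised. [cite: ChungZhao1995, Thm 2.4] -/
theorem stub_localTubeCore :
    ∀ (N : ℕ) (L b m : ℝ) (Y Xs : Config N), 0 < L → 0 ≤ b → 0 < m →
      Y ∈ boxN N L → Xs ∈ boxN N L →
      (∀ θ : ℝ, θ ∈ Set.Icc (0 : ℝ) 1 → ∀ i j : Fin N, i ≠ j →
        b + 2 * m ≤ ‖(1 - θ) • (Y i - Y j) + θ • (Xs i - Xs j)‖) →
      ∀ A : Set (Config N), MeasurableSet A →
      (∀ δ : ℝ, 0 < δ → 0 < volume (A ∩ {Z : Config N | ∀ i k, |Z i k - Xs i k| < δ})) →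
      ∀ C : ℝ≥0, ∃ c : ℝ, 0 < c ∧ ∃ δ₀ : ℝ, 0 < δ₀ ∧ ∀ w : ℝ → ℝ≥0∞, Measurable w →
        (∀ s : ℝ, b + m ≤ s → w s ≤ C) →
        ∀ Y' : Config N, (∀ i k, |Y' i k - Y i k| ≤ δ₀) →
          c ≤ fkReal w L 1 (A.indicator fun _ => (1 : ℝ)) Y' := by
  intro N L b m Y Xs _hL _hb hm hY hXs hseg A hA hAvol C
  set g : Config N → ℝ := A.indicator fun _ => (1 : ℝ) with hg
  have hgm : Measurable g := measurable_const.indicator hA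
  have hg0 : ∀ W, 0 ≤ g W := fun W => Set.indicator_nonneg (fun _ _ => zero_le_one) W
  have hg2 : ∫⁻ W in boxN N L, ‖g W‖ₑ ^ (2 : ℝ) ≠ ⊤ := setLIntegral_indicator_sq_ne_top A L id
  -- the small coordinate box `Q` of half-width `ℓ ≤ m / 4` around `X⋆` and its corner `Z₀`
  obtain ⟨μ, hμ, hμbox⟩ := exists_margin_segment hXs hXs
  set ℓ : ℝ := min μ (m / 4)
  have hℓ0 : 0 < ℓ := lt_min hμ (by positivity)
  have hℓm : 4 * ℓ ≤ m := by linarith [min_le_right μ (m / 4)]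
  set Z₀ : Config N := fun i => Xs i - WithLp.toLp 2 (fun _ : Fin 3 => ℓ) with hZ₀def
  have hZ₀ : ∀ i k, Z₀ i k = Xs i k - ℓ := by
    intro i k
    simp [hZ₀def]
  -- `Q ⊆ Λ_L^N` and all pairs in `Q` are `≥ b + m`: the interaction is `≤ N² C`, uniformly in `w`
  have hQ : ∀ w : ℝ → ℝ≥0∞, (∀ s : ℝ, b + m ≤ s → w s ≤ C) → ∀ W : Config N,
      W - Z₀ ∈ boxN N (2 * ℓ) → W ∈ boxN N L ∧ interaction w W ≤ (N * N : ℕ) * C := by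
    intro w hwC W hW
    have hco := (sub_mem_boxN_iff hZ₀ W).1 hW
    refine ⟨hμbox W 0 ⟨le_rfl, zero_le_one⟩ fun i k => ?_, interaction_le_of_far hwC
      (pair_ge_of_clearance hseg hℓ0.le hℓm ⟨zero_le_one, le_rfl⟩ (W := W) fun i k => ?_)⟩
    · rw [show (1 - (0 : ℝ)) * Xs i k + 0 * Xs i k = Xs i k by ring]
      exact (hco i k).le.trans (min_le_left _ _)
    · rw [show (1 - (1 : ℝ)) * Y i k + 1 * Xs i k = Xs i k by ring]
      exact (hco i k).le
  -- the FREE killed functional of the translated observable in the standard box `Λ_{2ℓ}^N`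
  set g' : Config N → ℝ := fun W => g (W + Z₀) with hg'
  have hg'm : Measurable g' := hgm.comp (measurable_add_const Z₀)
  have hg'2 : ∫⁻ W in boxN N (2 * ℓ), ‖g' W‖ₑ ^ (2 : ℝ) ≠ ⊤ :=
    setLIntegral_indicator_sq_ne_top A _ fun W => W + Z₀
  have hC0 : ∀ s : ℝ, (fun _ : ℝ => (0 : ℝ≥0∞)) s ≤ ((0 : ℝ≥0) : ℝ≥0∞) := fun _ => bot_le
  set F : Config N → ℝ := fkReal (fun _ : ℝ => (0 : ℝ≥0∞)) (2 * ℓ) (1 / 2) g'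
  have hctr_mem : Xs - Z₀ ∈ boxN N (2 * ℓ) := fun i k => by
    rw [show (Xs - Z₀) i k = ℓ by simp only [Pi.sub_apply, PiLp.sub_apply, hZ₀, sub_sub_cancel]]
    exact ⟨hℓ0, by linarith⟩
  -- `g'` is not a.e. zero on the standard box: `A` charges `Q`, translation invariance
  have hne : ¬ g' =ᵐ[volume.restrict (boxN N (2 * ℓ))] 0 := by
    intro h0
    set S : Set (Config N) :=
      (fun W => W + Z₀) ⁻¹' (A ∩ {Z : Config N | ∀ i k, |Z i k - Xs i k| < ℓ}) with hS
    have hS1 : S ⊆ {W | ¬ g' W = (0 : Config N → ℝ) W} := by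
      intro W hW
      have hWA : W + Z₀ ∈ A := hW.1
      simp [hg', hg, hWA]
    have hS2 : S ⊆ boxN N (2 * ℓ) := by
      rintro W ⟨-, hWQ⟩
      have := (sub_mem_boxN_iff hZ₀ (W + Z₀)).2 hWQ
      rwa [add_sub_cancel_right] at this
    have h1 : volume.restrict (boxN N (2 * ℓ)) S = 0 := measure_mono_null hS1 (ae_iff.1 h0)
    rw [Measure.restrict_apply' (measurableSet_boxN N (2 * ℓ)), Set.inter_eq_left.2 hS2, hS,
      measure_preimage_add_right] at h1
    exact (hAvol ℓ hℓ0).ne' h1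
  -- positivity at the centre and continuity there (the free functional: `v = 0` is bounded)
  have hFpos : 0 < F (Xs - Z₀) :=
    fkReal_pos_of_nonneg measurable_const hC0 one_half_pos hg'm (fun W => hg0 _) hg'2 hne hctr_mem
  obtain ⟨δ, hδ, hδF⟩ := Metric.continuousAt_iff.1
    (continuousAt_fkReal measurable_const hC0 (2 * ℓ) one_half_pos hg'm hg'2 hctr_mem)
    (F (Xs - Z₀) / 2) (half_pos hFpos)
  have h32 : Real.sqrt 3 ≤ 2 := (Real.sqrt_le_left (by norm_num)).2 (by norm_num)
  have hFge : ∀ Z : Config N, (∀ i k, |Z i k - Xs i k| ≤ δ / 4) →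
      F (Xs - Z₀) / 2 ≤ F (Z - Z₀) := by
    intro Z hZ
    have hd : dist (Z - Z₀) (Xs - Z₀) < δ := by
      rw [dist_sub_right]
      have h1 := dist_le_of_abs_coord_le (by positivity) hZ
      linarith [mul_le_mul_of_nonneg_right h32 (by positivity : (0 : ℝ) ≤ δ / 4)]
    have hdist := hδF hd
    rw [Real.dist_eq, abs_sub_lt_iff] at hdist
    linarith [hdist.1, hdist.2]
  -- tube data (independent of `w` and of the start `Y'`): half-width `ε`, start radius `ε / 2`
  obtain ⟨εm, hεm, hmarginY⟩ := exists_margin_segment hY hXs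
  set ε₁ : ℝ := min εm (min (m / 4) (δ / 4))
  have hε₁ : 0 < ε₁ := lt_min hεm (lt_min (by positivity) (by positivity))
  have hε₁m : ε₁ ≤ εm := min_le_left _ _
  have hε₁4 : ε₁ ≤ m / 4 := (min_le_right _ _).trans (min_le_left _ _)
  have hε₁δ : ε₁ ≤ δ / 4 := (min_le_right _ _).trans (min_le_right _ _)
  set ε : ℝ := ε₁ / 2 with hεdef
  have hε0 : 0 < ε := half_pos hε₁
  set t : ℝ≥0 := (1 / 2 : ℝ).toNNReal with htdef
  have ht0 : t ≠ 0 := by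
    rw [htdef]
    exact fun h0 => absurd (Real.toNNReal_eq_zero.1 h0) (not_le.2 one_half_pos)
  have htc : (t : ℝ) = 1 / 2 := Real.coe_toNNReal _ one_half_pos.le
  set E : Set (PathSpace N) := {ω | ∀ (i : Fin N) (k : Fin 3) (q : ℚ), (q : ℝ) ∈ Set.Icc (0 : ℝ) t →
    |brownian (q : ℝ).toNNReal (ω i k) - ((q : ℝ) / t) * ((Xs i k - Y i k) / Real.sqrt 2)| ≤
      ε / 2 / Real.sqrt 2}
  have hPE : 0 < wienerPaths N E :=
    measure_ratTube_pos t ht0 (fun i k => (Xs i k - Y i k) / Real.sqrt 2)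
      (ε := ε / 2 / Real.sqrt 2) (by positivity)
  set κ : ℝ := Real.exp (-((N * N : ℕ) * C * (1 / 2 : ℝ)))
  set a : ℝ := κ * (F (Xs - Z₀) / 2)
  have ha0 : 0 < a := mul_pos (Real.exp_pos _) (half_pos hFpos)
  refine ⟨Real.exp (-((N * N : ℕ) * C * t)) * a * (wienerPaths N E).toReal,
    mul_pos (mul_pos (Real.exp_pos _) ha0) (ENNReal.toReal_pos hPE.ne' (measure_ne_top _ _)),
    ε / 2, half_pos hε0, fun w hw hwC Y' hY' => ?_⟩
  -- (1) semigroup law: `e^{-H} g = e^{-H/2} h` with `h = e^{-H/2} g`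
  set h : Config N → ℝ := fkReal w L (1 / 2) g with hh
  have hhm : Measurable h := measurable_fkReal hw L _ hgm
  have hh0 : ∀ Z, 0 ≤ h Z := fun Z => fkReal_nonneg w L _ hg0 Z
  have hh2 : ∫⁻ Z in boxN N L, ‖h Z‖ₑ ^ (2 : ℝ) ≠ ⊤ :=
    ne_top_of_le_ne_top hg2 (setLIntegral_enorm_fkReal_sq_le hw L one_half_pos.le hgm)
  have hsemi : fkReal w L 1 g Y' = fkReal w L t h Y' := by
    rw [htc, hh, ← fkReal_add_time hw L one_half_pos one_half_pos hgm hg2 Y', add_halves]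
  -- (2) `h ≥ a` on the coordinate `ε`-box around `X⋆`, uniformly in `w`
  have hha : ∀ Z : Config N, (∀ i k, |Z i k - Xs i k| ≤ ε) → a ≤ h Z := by
    intro Z hZ
    calc a ≤ κ * F (Z - Z₀) :=
          mul_le_mul_of_nonneg_left (hFge Z fun i k => (hZ i k).trans (by linarith))
            (Real.exp_pos _).le
      _ ≤ h Z := exp_mul_fkReal_shift_le hw Z₀ (hQ w hwC) one_half_pos hgm hg0 hg2 Z
  -- (3) the tube from `Y'` to `X⋆`: its `ε`-neighbourhood is `(ε + ε/2)`-close to `[Y, X⋆]`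
  have hloc : ∀ (W : Config N) (θ : ℝ), θ ∈ Set.Icc (0 : ℝ) 1 →
      (∀ i k, |W i k - ((1 - θ) * Y' i k + θ * Xs i k)| ≤ ε) →
        W ∈ boxN N L ∧ interaction w W ≤ (N * N : ℕ) * C := by
    intro W θ hθ hW
    have hW' : ∀ i k, |W i k - ((1 - θ) * Y i k + θ * Xs i k)| ≤ ε + ε / 2 :=
      abs_sub_segment_le_add hθ hY' hW
    exact ⟨hmarginY W θ hθ fun i k => (hW' i k).trans (by linarith),
      interaction_le_of_far hwC
        (pair_ge_of_clearance hseg (by positivity) (by linarith) hθ hW')⟩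
  -- (4) the tube event for the drift `X⋆ - Y'` contains `E`, uniformly in `Y'`
  have hEE' := ratTube_subset_of_near (Xs := Xs) (t := t) (ε := ε) le_rfl hY'
  have hlow := fkReal_ge_of_localTube hw ht0 hloc hhm hh0 hh2 ha0.le hha
  rw [hsemi]
  refine le_trans (mul_le_mul_of_nonneg_left ?_ (by positivity)) hlow
  exact ENNReal.toReal_mono (measure_ne_top _ _) (measure_mono hEE')

end Summit.AtomisticToContinuum.BoseEinsteinCondensation.Theorems.GroundStateRigidity

end
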